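import Literature.Geometry.Kaehler.ComplexTorusHodgeGroupHodgeClassesOfPowers
import Literature.Geometry.Kaehler.ComplexTorusHodgeClassesProductHodgeGroup
import Literature.Geometry.Kaehler.ComplexTorusHodgeClassesMaps
import HarnessLib

/-!
# Moonen–Zarhin 1999 (3.1), the converse half: exceptional Hodge classes on `X₁^N × X₂^N` when `Hg(X₁ × X₂) ≠ Hg(X₁) × Hg(X₂)`

[cite: MoonenZarhin1999LowDim, §3 (3.1) (p0006 L57–L62)] [cite: Lange2023AbelianVarietiesComplex, §7.2.4 Exercise (1) (p. 334)]
[cite: GreenGriffithsKerr2012, §I.B (I.B.1) (p0036)]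

Moonen–Zarhin 1999, §3 (3.1) (arXiv math/9901113, p0006 L57–L62, verbatim): "We may have that
`Hg(X₁ × X₂) ≠ Hg(X₁) × Hg(X₂)`. (1) (I.e., `𝔤₃ ≠ 0` in the above.) This holds if and only if for some `m` and `n`
the Hodge ring `B•(X₁^m × X₂^n)` is not generated by the elements coming from `B•(X₁^m)` and `B•(X₂^n)`."

The sibling file `ComplexTorusHodgeClassesProductHodgeGroup` proves, AT TORUS LEVEL for two arbitrary complex tori
`X₁ = E₁/Φ₁(ℤ^{ι₁})`, `X₂ = E₂/Φ₂(ℤ^{ι₂})`, the half "`Hg(X₁ × X₂) = Hg(X₁) × Hg(X₂)` ⟹ for all `m, n ≥ 1` the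
Hodge classes of `X₁^m × X₂^n` are the `ℚ`-span of the cross products of Hodge classes of the factors"
(`hodgeClasses_prod_pow_eq_span_cross_of_prod_le_hodgeGroup`).  This file proves the CONVERSE half and hence the
printed "if and only if" (with `m = n = N`):

* `prod_le_hodgeGroup_of_forall_hodgeClasses_prod_pow_le_span`: if for every `N ≥ 1` and every `p` the Hodge
  classes `H^{2p}_Hodge(X₁^N × X₂^N)` lie in the span of the cross products `pr₁^*γ ∧ pr₂^*δ` of Hodge classes
  of `X₁^N` and `X₂^N`, then `Hg(X₁)(ℝ) × Hg(X₂)(ℝ) ⊆ Hg(X₁ × X₂)(ℝ)` (block-diagonally);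
* `prod_le_hodgeGroup_iff_forall_hodgeClasses_prod_pow_eq_span` and
  `not_prod_le_hodgeGroup_iff_exists_hodgeClasses_prod_pow_ne_span`: (3.1) as an equivalence — the product
  group fails to lie in `Hg(X₁ × X₂)` iff some `X₁^N × X₂^N` (`N ≥ 1`) carries a Hodge class outside the span of
  the cross products (an EXCEPTIONAL class);
* with the tree's `hodgeGroup_prod_le` (`Hg(X₁ × X₂) ⊆ Hg(X₁) × Hg(X₂)` always):
  `hodgeGroup_prod_eq_iff_forall_hodgeClasses_prod_pow_eq_span`.

PROOF (the source gives none; this is GGK's Basic Property (I) / Lange's Exercise (1) at work): by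
`mem_hodgeGroup_iff_forall_pow_compContinuousLinearMap_eq` (file `ComplexTorusHodgeGroupHodgeClassesOfPowers`) a
real point `(A 0; 0 B)`, `A ∈ Hg(X₁)(ℝ)`, `B ∈ Hg(X₂)(ℝ)`, lies in `Hg(X₁ × X₂)(ℝ)` as soon as its diagonal
`Δ_N (A 0; 0 B)` fixes every Hodge class of every power `(X₁ × X₂)^N`.  Transport such a class along the
isomorphism of complex tori `X₁^N × X₂^N ≅ (X₁ × X₂)^N` (§2: the `unshuffle`, a homomorphism of tori whose rational
representation is a permutation matrix and whose analytic representation is `ℂ`-linear, so Hodge classes pull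
back to Hodge classes — tree `comp_realRep_mem_hodgeClassesIn`); by hypothesis the transported class is a
`ℚ`-combination of cross products `pr₁^*γ ∧ pr₂^*δ`, `γ ∈ H^{2a}_Hodge(X₁^N)`, `δ ∈ H^{2b}_Hodge(X₂^N)`; under the
unshuffle the diagonal action of `(A 0; 0 B)` becomes `((Δ_N A) 0; 0 (Δ_N B))` (§2), which acts on a cross
product factorwise (Gordon's tensor-product step, tree `wedge_comp_fst_snd_compContinuousLinearMap_prodMap`), and
`Δ_N A ∈ Hg(X₁^N)`, `Δ_N B ∈ Hg(X₂^N)` fix `γ`, `δ` (Theorem 7.2.4 on the powers, `hodgeGroup_pow`) (§3).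

NOT here: the case `m ≠ n` separately (covered: `N = max(m, n)` is not needed for the equivalence as stated);
the Lie-algebra criteria (3.5)/(3.8) and Hazama's theorem (3.2); the Mumford–Tate group. The Hodge conjecture is
not addressed.

## References

* [MoonenZarhin1999LowDim] B. Moonen, Yu. Zarhin, *Hodge classes on abelian varieties of low dimension*,
  Math. Ann. 315 (1999) 711–733, arXiv math/9901113, §1 (p0002 L138–L141), §3 (3.1) (p0006 L57–L62).
* [Lange2023AbelianVarietiesComplex] H. Lange, *Abelian Varieties over the Complex Numbers* (2023), §7.2.4
  Exercise (1) (p. 334); §7.2.2 Thm. 7.2.4 (p. 331); §7.3.3 Exercise (1); §1.1.2.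
* [GreenGriffithsKerr2012] M. Green, P. Griffiths, M. Kerr, *Mumford–Tate Groups and Domains* (2012), §I.B (I.B.1)
  (p0036), §III.B (i) (p. 72).
* [Gordon1997] B. B. Gordon, *A survey of the Hodge conjecture for abelian varieties* (App. B to Lewis' Survey),
  §3 Theorem and proof (p0014 L25–L33).
-/

noncomputable section

open scoped Matrix Kronecker
open Matrix

namespace Literature.Geometry.Kaehler

namespace ComplexTorus

/-! ## §1 The diagonal action on a power is componentwise -/

section PowDiag

variable {ι : Type*} [Fintype ι] [DecidableEq ι] {E : Type*} [NormedAddCommGroup E] [NormedSpace ℂ E]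
  (Φ : (ι → ℝ) ≃L[ℝ] E) (N : ℕ)

/-- **The diagonal action on a power is componentwise**: `ρ_{X^N}(Δ_N M) (f) = (ρ_X(M) (f k))_k`.
[cite: MoonenZarhin1999LowDim, §1 (p0002 L138: "acting diagonally on `V_{Xⁿ} = (V_X)ⁿ`")] -/
theorem analyticRepReal_powPeriod_diagPow (M : Matrix ι ι ℝ) (f : Fin N → E) :
    analyticRepReal (powPeriod Φ N) (powPeriod Φ N) (diagPow ι N M) f = fun k ↦ analyticRepReal Φ Φ M (f k) := by
  obtain ⟨x, rfl⟩ := (powPeriod Φ N).surjective f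
  rw [analyticRepReal_apply]
  funext k
  rw [powPeriod_apply, powPeriod_apply, analyticRepReal_apply]
  congr 1
  funext i
  simp only [Matrix.mulVec, dotProduct, diagPow_apply_apply, Fintype.sum_prod_type, ite_mul, zero_mul]
  rw [Finset.sum_comm]
  simp only [Finset.sum_ite_eq, Finset.mem_univ, if_true]

end PowDiag

/-! ## §2 The isomorphism `X₁^N × X₂^N ≅ (X₁ × X₂)^N` and the transport of Hodge classes -/

section Shuffle

variable {ι₁ ι₂ : Type*} [Fintype ι₁] [Fintype ι₂] [DecidableEq ι₁] [DecidableEq ι₂]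
  {E₁ E₂ : Type*} [NormedAddCommGroup E₁] [NormedSpace ℂ E₁] [NormedAddCommGroup E₂] [NormedSpace ℂ E₂]
  (Φ₁ : (ι₁ → ℝ) ≃L[ℝ] E₁) (Φ₂ : (ι₂ → ℝ) ≃L[ℝ] E₂) (N : ℕ)

variable (ι₁ ι₂) in
/-- The lattice index relabelling `(Fin N × ι₁) ⊕ (Fin N × ι₂) → Fin N × (ι₁ ⊕ ι₂)` behind `X₁^N × X₂^N ≅ (X₁ × X₂)^N`.
[cite: MoonenZarhin1999LowDim, §1 (p0002 L138–L141: "we can identify `Hg(X₁^{n₁} × ⋯ × X_r^{n_r})` with `Hg(X₁ × ⋯ × X_r)`")] -/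
def powProdIndex : (Fin N × ι₁) ⊕ (Fin N × ι₂) → Fin N × (ι₁ ⊕ ι₂) :=
  Sum.elim (fun ki ↦ (ki.1, Sum.inl ki.2)) fun kj ↦ (kj.1, Sum.inr kj.2)

variable (ι₁ ι₂) in
/-- The inverse relabelling `Fin N × (ι₁ ⊕ ι₂) → (Fin N × ι₁) ⊕ (Fin N × ι₂)`. [cite: MoonenZarhin1999LowDim, §1 (p0002 L138–L141)] -/
def prodPowIndex : Fin N × (ι₁ ⊕ ι₂) → (Fin N × ι₁) ⊕ (Fin N × ι₂) :=
  fun q ↦ Sum.elim (fun i ↦ Sum.inl (q.1, i)) (fun j ↦ Sum.inr (q.1, j)) q.2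

/-- A coordinate relabelling as a homomorphism of tori: `ρ(1.submatrix σ id)(Ψ x) = Ψ'(x ∘ σ)`. [cite: Lange2023AbelianVarietiesComplex, §1.1.2] -/
private theorem realRep_one_submatrix_apply'' {κ κ' : Type*} [Fintype κ] [DecidableEq κ] [Fintype κ'] {F F' : Type*}
    [NormedAddCommGroup F] [NormedSpace ℂ F] [NormedAddCommGroup F'] [NormedSpace ℂ F']
    (Ψ : (κ → ℝ) ≃L[ℝ] F) (Ψ' : (κ' → ℝ) ≃L[ℝ] F') (σ : κ' → κ) (x : κ → ℝ) :
    realRep Ψ Ψ' ((1 : Matrix κ κ ℤ).submatrix σ id) (Ψ x) = Ψ' (fun i ↦ x (σ i)) := by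
  rw [realRep_apply]
  congr 1
  funext i
  simp only [Matrix.mulVec, dotProduct, Matrix.map_apply, Matrix.submatrix_apply, id_eq, Matrix.one_apply,
    Int.cast_ite, Int.cast_one, Int.cast_zero, ite_mul, one_mul, zero_mul, Finset.sum_ite_eq, Finset.mem_univ,
    if_true]

/-- **The unshuffle `X₁^N × X₂^N → (X₁ × X₂)^N`** as a homomorphism of tori (rational representation a permutation
matrix): `((f₁, f₂)) ↦ (k ↦ (f₁ k, f₂ k))`. [cite: MoonenZarhin1999LowDim, §1 (p0002 L138–L141)] -/
def unshuffle : ((Fin N → E₁) × (Fin N → E₂)) →L[ℝ] (Fin N → E₁ × E₂) :=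
  realRep (prodPeriod (powPeriod Φ₁ N) (powPeriod Φ₂ N)) (powPeriod (prodPeriod Φ₁ Φ₂) N)
    ((1 : Matrix ((Fin N × ι₁) ⊕ (Fin N × ι₂)) ((Fin N × ι₁) ⊕ (Fin N × ι₂)) ℤ).submatrix (prodPowIndex ι₁ ι₂ N) id)

/-- **The shuffle `(X₁ × X₂)^N → X₁^N × X₂^N`**: `f ↦ ((k ↦ (f k).1), (k ↦ (f k).2))`. [cite: MoonenZarhin1999LowDim, §1 (p0002 L138–L141)] -/
def shuffle : (Fin N → E₁ × E₂) →L[ℝ] ((Fin N → E₁) × (Fin N → E₂)) :=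
  realRep (powPeriod (prodPeriod Φ₁ Φ₂) N) (prodPeriod (powPeriod Φ₁ N) (powPeriod Φ₂ N))
    ((1 : Matrix (Fin N × (ι₁ ⊕ ι₂)) (Fin N × (ι₁ ⊕ ι₂)) ℤ).submatrix (powProdIndex ι₁ ι₂ N) id)

/-- `unshuffle (f₁, f₂) = (k ↦ (f₁ k, f₂ k))`. [cite: MoonenZarhin1999LowDim, §1 (p0002 L138–L141)] -/
@[simp] theorem unshuffle_apply (f : (Fin N → E₁) × (Fin N → E₂)) :
    unshuffle Φ₁ Φ₂ N f = fun k ↦ (f.1 k, f.2 k) := by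
  obtain ⟨y, rfl⟩ := (prodPeriod (powPeriod Φ₁ N) (powPeriod Φ₂ N)).surjective f
  rw [unshuffle, realRep_one_submatrix_apply'']
  funext k
  simp only [powPeriod_apply, prodPeriod_apply, prodPowIndex, Sum.elim_inl, Sum.elim_inr]

/-- `shuffle f = ((k ↦ (f k).1), (k ↦ (f k).2))`. [cite: MoonenZarhin1999LowDim, §1 (p0002 L138–L141)] -/
@[simp] theorem shuffle_apply (f : Fin N → E₁ × E₂) :
    shuffle Φ₁ Φ₂ N f = (fun k ↦ (f k).1, fun k ↦ (f k).2) := by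
  obtain ⟨x, rfl⟩ := (powPeriod (prodPeriod Φ₁ Φ₂) N).surjective f
  rw [shuffle, realRep_one_submatrix_apply'', prodPeriod_apply]
  refine Prod.ext (funext fun k ↦ ?_) (funext fun k ↦ ?_) <;>
    simp only [powPeriod_apply, prodPeriod_apply, powProdIndex, Sum.elim_inl, Sum.elim_inr]

/-- `unshuffle ∘ shuffle = id`. [cite: MoonenZarhin1999LowDim, §1 (p0002 L138–L141)] -/
theorem unshuffle_shuffle (f : Fin N → E₁ × E₂) : unshuffle Φ₁ Φ₂ N (shuffle Φ₁ Φ₂ N f) = f := by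
  rw [shuffle_apply, unshuffle_apply]

/-- `shuffle ∘ unshuffle = id`. [cite: MoonenZarhin1999LowDim, §1 (p0002 L138–L141)] -/
theorem shuffle_unshuffle (f : (Fin N → E₁) × (Fin N → E₂)) : shuffle Φ₁ Φ₂ N (unshuffle Φ₁ Φ₂ N f) = f := by
  rw [unshuffle_apply, shuffle_apply]

/-- The unshuffle is `ℂ`-linear (an isomorphism of complex tori). [cite: MoonenZarhin1999LowDim, §1 (p0002 L138–L141)] -/
theorem unshuffle_smul (c : ℂ) (f : (Fin N → E₁) × (Fin N → E₂)) :
    unshuffle Φ₁ Φ₂ N (c • f) = c • unshuffle Φ₁ Φ₂ N f := by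
  rw [unshuffle_apply, unshuffle_apply]
  rfl

/-- **Transport of Hodge classes along `X₁^N × X₂^N ≅ (X₁ × X₂)^N`**: the pull-back of a Hodge class of `(X₁ × X₂)^N`
along the unshuffle is a Hodge class of `X₁^N × X₂^N`. [cite: Lange2023AbelianVarietiesComplex, §7.3.3 Exercise (1) (pull-back of Hodge classes)] [cite: MoonenZarhin1999LowDim, §1 (p0002 L138–L141)] -/
theorem compContinuousLinearMap_unshuffle_mem_hodgeClasses {p : ℕ} {ω : (Fin N → E₁ × E₂) [⋀^Fin (2 * p)]→L[ℝ] ℂ}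
    (hω : ω ∈ hodgeClasses (powPeriod (prodPeriod Φ₁ Φ₂) N) p) :
    ω.compContinuousLinearMap (unshuffle Φ₁ Φ₂ N) ∈ hodgeClasses (prodPeriod (powPeriod Φ₁ N) (powPeriod Φ₂ N)) p :=
  comp_realRep_mem_hodgeClassesIn _ _ _ (unshuffle_smul Φ₁ Φ₂ N) hω

/-- **The diagonal block-diagonal action commutes with the unshuffle**:
`ρ_{(X₁×X₂)^N}(Δ_N (A 0; 0 B)) ∘ unshuffle = unshuffle ∘ ρ_{X₁^N × X₂^N}((Δ_N A) 0; 0 (Δ_N B))`.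
[cite: MoonenZarhin1999LowDim, §1 (p0002 L138–L141)] [cite: GreenGriffithsKerr2012, §III.B (i) (p. 72)] -/
theorem analyticRepReal_diagPow_fromBlocks_comp_unshuffle (A : Matrix ι₁ ι₁ ℝ) (B : Matrix ι₂ ι₂ ℝ) :
    (analyticRepReal (powPeriod (prodPeriod Φ₁ Φ₂) N) (powPeriod (prodPeriod Φ₁ Φ₂) N)
        (diagPow (ι₁ ⊕ ι₂) N (Matrix.fromBlocks A 0 0 B))).comp (unshuffle Φ₁ Φ₂ N) =
      (unshuffle Φ₁ Φ₂ N).comp (analyticRepReal (prodPeriod (powPeriod Φ₁ N) (powPeriod Φ₂ N))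
        (prodPeriod (powPeriod Φ₁ N) (powPeriod Φ₂ N))
        (Matrix.fromBlocks (diagPow ι₁ N A) 0 0 (diagPow ι₂ N B))) := by
  refine ContinuousLinearMap.ext fun f ↦ ?_
  simp only [ContinuousLinearMap.comp_apply, analyticRepReal_powPeriod_diagPow, analyticRepReal_prodPeriod_fromBlocks,
    ContinuousLinearMap.coe_prodMap', Prod.map_apply, unshuffle_apply]
  funext k
  rw [Prod.map_fst, Prod.map_snd, analyticRepReal_powPeriod_diagPow, analyticRepReal_powPeriod_diagPow]

/-! ## §3 Invariance of the cross products under the block-diagonal diagonal action -/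

/-- **`Δ_N A ∈ Hg(X₁^N)` fixes the Hodge classes of `X₁^N`** (Theorem 7.2.4 on the power, `Hg(X^N) = Δ_N Hg(X)`).
[cite: Lange2023AbelianVarietiesComplex, §7.2.2 Thm. 7.2.4 (p. 331)] [cite: MoonenZarhin1999LowDim, §1 (p0002 L138)] -/
theorem compContinuousLinearMap_diagPow_eq_of_mem_hodgeGroup {ι : Type*} [Fintype ι] [DecidableEq ι] {E : Type*}
    [NormedAddCommGroup E] [NormedSpace ℂ E] (Φ : (ι → ℝ) ≃L[ℝ] E) (N : ℕ) {A : SpecialLinearGroup ι ℝ}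
    (hA : A ∈ hodgeGroup Φ) {a : ℕ} {γ : (Fin N → E) [⋀^Fin (2 * a)]→L[ℝ] ℂ} (hγ : γ ∈ hodgeClasses (powPeriod Φ N) a) :
    γ.compContinuousLinearMap (analyticRepReal (powPeriod Φ N) (powPeriod Φ N) (diagPow ι N A.1)) = γ := by
  have hM : diagPowSL ι N A ∈ hodgeGroup (powPeriod Φ N) := by
    rw [hodgeGroup_pow]
    exact Subgroup.mem_map_of_mem _ hA
  have h := compContinuousLinearMap_eq_of_mem_hodgeGroup (powPeriod Φ N) hγ hM
  rwa [coe_diagPowSL] at h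

/-- **The span of the cross products of Hodge classes of `X₁^N` and `X₂^N` is fixed by
`ρ((Δ_N A) 0; 0 (Δ_N B))` for `A ∈ Hg(X₁)(ℝ)`, `B ∈ Hg(X₂)(ℝ)`** — the cross products transform factorwise
(Gordon's tensor-product step) and each factor is fixed (Theorem 7.2.4 on the powers).
[cite: MoonenZarhin1999LowDim, §3 (3.1) (p0006 L57–L62)] [cite: Gordon1997, §3 Theorem (proof, p0014 L25–L33)] [cite: Lange2023AbelianVarietiesComplex, §7.2.2 Thm. 7.2.4] -/
theorem compContinuousLinearMap_eq_of_mem_span_cross {A : SpecialLinearGroup ι₁ ℝ} {B : SpecialLinearGroup ι₂ ℝ}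
    (hA : A ∈ hodgeGroup Φ₁) (hB : B ∈ hodgeGroup Φ₂) {p : ℕ}
    {x : ((Fin N → E₁) × (Fin N → E₂)) [⋀^Fin (2 * p)]→L[ℝ] ℂ}
    (hx : x ∈ Submodule.span ℚ
      {x | ∃ (a b : ℕ) (h : 2 * a + 2 * b = 2 * p) (γ : (Fin N → E₁) [⋀^Fin (2 * a)]→L[ℝ] ℂ)
          (δ : (Fin N → E₂) [⋀^Fin (2 * b)]→L[ℝ] ℂ),
        γ ∈ hodgeClasses (powPeriod Φ₁ N) a ∧ δ ∈ hodgeClasses (powPeriod Φ₂ N) b ∧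
          x = ((γ.compContinuousLinearMap (ContinuousLinearMap.fst ℝ (Fin N → E₁) (Fin N → E₂))).wedge
            (δ.compContinuousLinearMap (ContinuousLinearMap.snd ℝ (Fin N → E₁) (Fin N → E₂)))).domDomCongr
              (finCongr h)}) :
    x.compContinuousLinearMap (analyticRepReal (prodPeriod (powPeriod Φ₁ N) (powPeriod Φ₂ N))
        (prodPeriod (powPeriod Φ₁ N) (powPeriod Φ₂ N))
        (Matrix.fromBlocks (diagPow ι₁ N A.1) 0 0 (diagPow ι₂ N B.1))) = x := by
  rw [analyticRepReal_prodPeriod_fromBlocks]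
  refine Submodule.span_induction ?_ ?_ ?_ ?_ hx
  · rintro _ ⟨a, b, h, γ, δ, hγ, hδ, rfl⟩
    rw [wedge_comp_fst_snd_compContinuousLinearMap_prodMap,
      compContinuousLinearMap_diagPow_eq_of_mem_hodgeGroup Φ₁ N hA hγ,
      compContinuousLinearMap_diagPow_eq_of_mem_hodgeGroup Φ₂ N hB hδ]
  · ext v
    rfl
  · intro y z _ _ hy hz
    conv_rhs => rw [← hy, ← hz]
    ext v
    rfl
  · intro q y _ hy
    conv_rhs => rw [← hy]
    ext v
    rfl

end Shuffle


/-! ## §4 Moonen–Zarhin (3.1): the converse half and the equivalence -/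

section Converse

variable {ι₁ ι₂ : Type*} [Fintype ι₁] [Fintype ι₂] [DecidableEq ι₁] [DecidableEq ι₂]
  {E₁ E₂ : Type*} [NormedAddCommGroup E₁] [NormedSpace ℂ E₁] [NormedAddCommGroup E₂] [NormedSpace ℂ E₂]
  (Φ₁ : (ι₁ → ℝ) ≃L[ℝ] E₁) (Φ₂ : (ι₂ → ℝ) ≃L[ℝ] E₂)

/-- **"The elements coming from `B•(X₁^N)` and `B•(X₂^N)`"**: the `ℚ`-span in `H^{2p}(X₁^N × X₂^N, ℂ)` of the
cross products `pr₁^*γ ∧ pr₂^*δ` of Hodge classes `γ ∈ H^{2a}_Hodge(X₁^N)`, `δ ∈ H^{2b}_Hodge(X₂^N)`, `a + b = p`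
(the right-hand side of the sibling file's `hodgeClasses_prod_pow_eq_span_cross_of_prod_le_hodgeGroup`, named).
[cite: MoonenZarhin1999LowDim, §3 (3.1) (p0006 L60–L62)] -/
def crossSpan (N p : ℕ) : Submodule ℚ (((Fin N → E₁) × (Fin N → E₂)) [⋀^Fin (2 * p)]→L[ℝ] ℂ) :=
  Submodule.span ℚ
    {x | ∃ (a b : ℕ) (h : 2 * a + 2 * b = 2 * p) (γ : (Fin N → E₁) [⋀^Fin (2 * a)]→L[ℝ] ℂ)
        (δ : (Fin N → E₂) [⋀^Fin (2 * b)]→L[ℝ] ℂ),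
      γ ∈ hodgeClasses (powPeriod Φ₁ N) a ∧ δ ∈ hodgeClasses (powPeriod Φ₂ N) b ∧
        x = ((γ.compContinuousLinearMap (ContinuousLinearMap.fst ℝ (Fin N → E₁) (Fin N → E₂))).wedge
          (δ.compContinuousLinearMap (ContinuousLinearMap.snd ℝ (Fin N → E₁) (Fin N → E₂)))).domDomCongr
            (finCongr h)}

omit [DecidableEq ι₁] [DecidableEq ι₂] in
/-- The cross products of Hodge classes of the factors are Hodge classes of `X₁^N × X₂^N` (always).
[cite: MoonenZarhin1999LowDim, §3 (3.1) (p0006 L60–L62)] [cite: Lange2023AbelianVarietiesComplex, §7.3.3 Exercise (1)] -/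
theorem crossSpan_le_hodgeClasses (N p : ℕ) :
    crossSpan Φ₁ Φ₂ N p ≤ hodgeClasses (prodPeriod (powPeriod Φ₁ N) (powPeriod Φ₂ N)) p := by
  refine Submodule.span_le.2 ?_
  rintro _ ⟨a, b, h, γ, δ, hγ, hδ, rfl⟩
  have hx := (domDomCongr_mem_hodgeClassesIn_iff _ h (a + b) _).2
    (wedge_comp_fst_snd_mem_hodgeClassesIn (powPeriod Φ₁ N) (powPeriod Φ₂ N) hγ hδ)
  rw [show a + b = p by omega] at hx
  exact hx

/-- **MZ99 (3.1), the "only if" restated from the sibling file**: `Hg(X₁)(ℝ) × Hg(X₂)(ℝ) ⊆ Hg(X₁ × X₂)(ℝ)` ⟹ the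
Hodge classes of every `X₁^N × X₂^N`, `N ≥ 1`, are spanned by the cross products.
[cite: MoonenZarhin1999LowDim, §3 (3.1) (p0006 L57–L62)] -/
theorem hodgeClasses_prod_pow_eq_crossSpan_of_prod_le_hodgeGroup
    (hle : ((hodgeGroup Φ₁).prod (hodgeGroup Φ₂)).map (blockDiag ι₁ ι₂) ≤ hodgeGroup (prodPeriod Φ₁ Φ₂))
    {N : ℕ} (hN : 0 < N) (p : ℕ) :
    hodgeClasses (prodPeriod (powPeriod Φ₁ N) (powPeriod Φ₂ N)) p = crossSpan Φ₁ Φ₂ N p :=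
  hodgeClasses_prod_pow_eq_span_cross_of_prod_le_hodgeGroup Φ₁ Φ₂ hle hN hN p

/-- **MOONEN–ZARHIN 1999 (3.1), THE CONVERSE HALF, at torus level**: if for every `N ≥ 1` and every `p` the Hodge
classes of `X₁^N × X₂^N` lie in the `ℚ`-span of the cross products of Hodge classes of `X₁^N` and `X₂^N` (no
exceptional classes on any `X₁^N × X₂^N`), then `Hg(X₁)(ℝ) × Hg(X₂)(ℝ) ⊆ Hg(X₁ × X₂)(ℝ)`, i.e.
`Hg(X₁ × X₂) = Hg(X₁) × Hg(X₂)`. Proof: Lange's Exercise (1) / GGK (I.B.1) for `X₁ × X₂`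
(`mem_hodgeGroup_iff_forall_pow_compContinuousLinearMap_eq`), transport along `X₁^N × X₂^N ≅ (X₁ × X₂)^N`, and
Theorem 7.2.4 on the powers of the factors. [cite: MoonenZarhin1999LowDim, §3 (3.1) (p0006 L57–L62)] [cite: Lange2023AbelianVarietiesComplex, §7.2.4 Exercise (1) (p. 334)] [cite: GreenGriffithsKerr2012, §I.B (I.B.1) (p0036)] -/
theorem prod_le_hodgeGroup_of_forall_hodgeClasses_prod_pow_le_span
    (H : ∀ (N p : ℕ), 0 < N → hodgeClasses (prodPeriod (powPeriod Φ₁ N) (powPeriod Φ₂ N)) p ≤ crossSpan Φ₁ Φ₂ N p) :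
    ((hodgeGroup Φ₁).prod (hodgeGroup Φ₂)).map (blockDiag ι₁ ι₂) ≤ hodgeGroup (prodPeriod Φ₁ Φ₂) := by
  rintro _ ⟨⟨A, B⟩, hAB, rfl⟩
  obtain ⟨hA, hB⟩ := Subgroup.mem_prod.1 hAB
  refine (mem_hodgeGroup_iff_forall_pow_compContinuousLinearMap_eq (prodPeriod Φ₁ Φ₂)).2 fun N p ω hω ↦ ?_
  rw [coe_blockDiag]
  rcases Nat.eq_zero_or_pos N with rfl | hN
  · ext v
    rw [ContinuousAlternatingMap.compContinuousLinearMap_apply]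
    congr 1
    funext t
    exact Subsingleton.elim _ _
  · have hω' := compContinuousLinearMap_unshuffle_mem_hodgeClasses Φ₁ Φ₂ N hω
    have hfix' := compContinuousLinearMap_eq_of_mem_span_cross Φ₁ Φ₂ N hA hB (H N p hN hω')
    have hRU := analyticRepReal_diagPow_fromBlocks_comp_unshuffle Φ₁ Φ₂ N A.1 B.1
    ext v
    have h1 := congrArg (fun δ : ((Fin N → E₁) × (Fin N → E₂)) [⋀^Fin (2 * p)]→L[ℝ] ℂ ↦
      δ (fun t ↦ shuffle Φ₁ Φ₂ N (v t))) hfix'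
    simp only [ContinuousAlternatingMap.compContinuousLinearMap_apply, Function.comp_def] at h1
    rw [ContinuousAlternatingMap.compContinuousLinearMap_apply]
    have hv : ω v = ω (fun t ↦ unshuffle Φ₁ Φ₂ N (shuffle Φ₁ Φ₂ N (v t))) := by
      simp only [unshuffle_shuffle]
    rw [hv, ← h1]
    congr 1
    funext t
    rw [Function.comp_apply, ← ContinuousLinearMap.comp_apply (unshuffle Φ₁ Φ₂ N), ← hRU,
      ContinuousLinearMap.comp_apply, unshuffle_shuffle]

/-- **MZ99 (3.1) as an equivalence, at torus level**: `Hg(X₁)(ℝ) × Hg(X₂)(ℝ) ⊆ Hg(X₁ × X₂)(ℝ)` (equivalently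
`Hg(X₁ × X₂) = Hg(X₁) × Hg(X₂)`, the other inclusion being `hodgeGroup_prod_le`) iff for all `N ≥ 1` and all `p`
the Hodge classes of `X₁^N × X₂^N` are generated by the cross products of those of `X₁^N` and `X₂^N`.
[cite: MoonenZarhin1999LowDim, §3 (3.1) (p0006 L57–L62)] -/
theorem prod_le_hodgeGroup_iff_forall_hodgeClasses_prod_pow_eq_crossSpan :
    ((hodgeGroup Φ₁).prod (hodgeGroup Φ₂)).map (blockDiag ι₁ ι₂) ≤ hodgeGroup (prodPeriod Φ₁ Φ₂) ↔
      ∀ (N p : ℕ), 0 < N → hodgeClasses (prodPeriod (powPeriod Φ₁ N) (powPeriod Φ₂ N)) p = crossSpan Φ₁ Φ₂ N p :=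
  ⟨fun hle _ p hN ↦ hodgeClasses_prod_pow_eq_crossSpan_of_prod_le_hodgeGroup Φ₁ Φ₂ hle hN p,
    fun h ↦ prod_le_hodgeGroup_of_forall_hodgeClasses_prod_pow_le_span Φ₁ Φ₂ fun N p hN ↦ (h N p hN).le⟩

/-- **MOONEN–ZARHIN 1999 (3.1), VERBATIM FORM, at torus level**: "`Hg(X₁ × X₂) ≠ Hg(X₁) × Hg(X₂)` […] holds if and
only if for some `m` and `n` the Hodge ring `B•(X₁^m × X₂^n)` is not generated by the elements coming from
`B•(X₁^m)` and `B•(X₂^n)`" — here with `m = n = N ≥ 1`: the block-diagonal product of the real points fails to lie in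
`Hg(X₁ × X₂)(ℝ)` iff some `X₁^N × X₂^N` carries an EXCEPTIONAL Hodge class (one outside the span of the cross
products). [cite: MoonenZarhin1999LowDim, §3 (3.1) (p0006 L57–L62)] -/
theorem not_prod_le_hodgeGroup_iff_exists_hodgeClasses_prod_pow_ne_crossSpan :
    ¬ ((hodgeGroup Φ₁).prod (hodgeGroup Φ₂)).map (blockDiag ι₁ ι₂) ≤ hodgeGroup (prodPeriod Φ₁ Φ₂) ↔
      ∃ (N p : ℕ), 0 < N ∧ hodgeClasses (prodPeriod (powPeriod Φ₁ N) (powPeriod Φ₂ N)) p ≠ crossSpan Φ₁ Φ₂ N p := by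
  rw [prod_le_hodgeGroup_iff_forall_hodgeClasses_prod_pow_eq_crossSpan]
  push Not
  exact Iff.rfl

/-- **(3.1) with the equality of groups**: `Hg(X₁ × X₂)(ℝ) = Hg(X₁)(ℝ) × Hg(X₂)(ℝ)` (block-diagonally; `⊆` always
holds, `hodgeGroup_prod_le`) iff no power `X₁^N × X₂^N`, `N ≥ 1`, carries an exceptional Hodge class.
[cite: MoonenZarhin1999LowDim, §3 (3.1) (p0006 L57–L62)] -/
theorem hodgeGroup_prod_eq_iff_forall_hodgeClasses_prod_pow_eq_crossSpan :
    hodgeGroup (prodPeriod Φ₁ Φ₂) = ((hodgeGroup Φ₁).prod (hodgeGroup Φ₂)).map (blockDiag ι₁ ι₂) ↔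
      ∀ (N p : ℕ), 0 < N → hodgeClasses (prodPeriod (powPeriod Φ₁ N) (powPeriod Φ₂ N)) p = crossSpan Φ₁ Φ₂ N p := by
  rw [← prod_le_hodgeGroup_iff_forall_hodgeClasses_prod_pow_eq_crossSpan]
  exact ⟨fun h ↦ h.symm.le, fun h ↦ le_antisymm (hodgeGroup_prod_le Φ₁ Φ₂) h⟩

/-- **Exceptional classes exist exactly when the Hodge group of the product is smaller** — the contrapositive
packaging used in the classification of low-dimensional abelian varieties: if `Hg(X₁ × X₂) ≠ Hg(X₁) × Hg(X₂)`
then some `X₁^N × X₂^N` carries a Hodge class which is not a `ℚ`-combination of cross products of Hodge classes of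
the factors. [cite: MoonenZarhin1999LowDim, §3 (3.1) (p0006 L57–L62)] -/
theorem exists_hodgeClasses_prod_pow_ne_crossSpan_of_hodgeGroup_prod_ne
    (hne : hodgeGroup (prodPeriod Φ₁ Φ₂) ≠ ((hodgeGroup Φ₁).prod (hodgeGroup Φ₂)).map (blockDiag ι₁ ι₂)) :
    ∃ (N p : ℕ), 0 < N ∧ ∃ γ ∈ hodgeClasses (prodPeriod (powPeriod Φ₁ N) (powPeriod Φ₂ N)) p,
      γ ∉ crossSpan Φ₁ Φ₂ N p := by
  by_contra hall
  push Not at hall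
  exact hne ((hodgeGroup_prod_eq_iff_forall_hodgeClasses_prod_pow_eq_crossSpan Φ₁ Φ₂).2 fun N p hN ↦
    le_antisymm (fun γ hγ ↦ hall N p hN γ hγ) (crossSpan_le_hodgeClasses Φ₁ Φ₂ N p))

end Converse

end ComplexTorus

end Literature.Geometry.Kaehler
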